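import Literature.NumberTheory.EllipticCurves.ComplexMultiplicationLocalFactorsAux
import Literature.NumberTheory.EllipticCurves.ThreeIsogenyKernelX
import Literature.NumberTheory.EllipticCurves.LocalReductionKrausTwo
import HarnessLib

/-!
# Equal `L`-functions across the CM isogeny class `j = -12288000 ~ j = 0` and all its twists

Sibling file of `Literature.NumberTheory.EllipticCurves.ComplexMultiplication` (D-0014 append
protocol; everything here is proved). The curve `E : y² = x³ + (6x - 4)²`, i.e.
`[0, 36, 0, -48, 16]` (`j = -12288000 = -2¹⁵3·5³`, CM by `ℤ + 3ℤ[ζ₃]`, the order of conductor `3`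
in `ℚ(√-3)`), is `3`-isogenous over `ℚ` to Vélu's quotient `[0, 36, 0, 432, 13392]`
(`j = 0`, CM by `ℤ[ζ₃]`) (the tree's `isIsogenous_cm27`, file `ThreeIsogeny`), and so are all its
quadratic twists `E_d = [0, 36d, 0, -48d², 16d³] → E'_d = [0, 36d, 0, 432d², 13392d³]` — the
kernel-`x` `3`-isogeny of `ThreeIsogenyKernelX` with `a = 36d`, `b = -48d²`, `c = 16d³`,
`b² = 4ac`. As in `ComplexMultiplicationLocalFactors16/12/28` we prove the corresponding instance
of Knapp's Theorem 11.67 (*Elliptic Curves*, p. 281; the named fact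
`Literature.NumberTheory.EllipticCurves.LFunction_eq_of_isIsogenous`) prime by prime for Mathlib's `WeierstrassCurve.LFunction`:
`L(E_d, s) = L(E'_d, s)` for every squarefree `d` (`WeierstrassCurve.LFunction_cm27_eq`).
Invariants: `Δ(E_d) = -2¹²3⁵d⁶`, `c₄(E_d) = 2⁹·45d²`, `c₆(E_d) = -2⁹·6831d³`;
`Δ(E'_d) = -2¹²3¹⁵d⁶`, `c₄(E'_d) = 0`, `c₆(E'_d) = -2⁹·3⁹d³`.

* `p ∤ 6d`: good reduction of both models and `#E_d(𝔽_p) = #E'_d(𝔽_p)` by the kernel-`x`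
  `3`-isogeny over `𝔽_p` and the prime-degree torsor lemma (`natCard_point_kernelXThree_eq`);
* `p = 3`, odd `p ∣ d`, `p = 2 ∣ d`: additive reduction of both (`ord_p(Δ) ∈ {5, 6, 11, 15, 18, 21}`,
  `ord_p(j) ≥ 0`);
* `p = 2`, `d ≡ 3 (mod 4)`: `ord₂(Δ_min) = 12`, no good reduction by **Kraus's necessary condition**
  (`c₆ = 2⁹L`, `L = -6831d³, -3⁹d³ ≡ 3 (mod 4)`; `not_hasGoodReductionAt_two_of_c₆_eq_512_mul`),
  hence additive;
* `p = 2`, `d ≡ 1 (mod 4)`, `d = 4k + 1`: **good reduction at `2` on both sides**, through the explicit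
  models `⟨2, -12d, 0, 4⟩ • E_d = [0, 0, 1, -30d², (253d³ - 1)/4]`,
  `⟨2, -12d, 0, 4⟩ • E'_d = [0, 0, 1, 0, (729d³ - 1)/4]` of odd discriminants `-3⁵d⁶`, `-3¹⁵d⁶`,
  whose reductions `y² + y = x³ (+ 1)` have three points each (supersingular: `2` is inert in
  `ℚ(√-3)`, `a₂ = 0`).

## References

* A. W. Knapp, *Elliptic Curves* (1992), Thm. 11.67 and its proof (PDF pp. 281–282). [cite: Knapp1993]
* J. H. Silverman, *AEC* 2nd ed. (2009), VII.1, VII.5.1, §C.16, Ex. 5.4(a). [cite: SilvermanAEC2009]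
* A. Kraus, Acta Arith. 54 (1989), Prop. 2; Cremona, *Algorithms*, §3.2, §3.8. [cite: Kraus1989]
* J. H. Silverman, *Advanced Topics* (1994), App. A §3 (`D = -3`, `f = 1, 3`).
  [cite: SilvermanAdvancedTopics1994, App. A §3]
-/

noncomputable section

open scoped Classical

open IsDedekindDomain NumberField Rat.HeightOneSpectrum Polynomial

namespace WeierstrassCurve

/-! ## The models -/

/-- The twist family of `y² = x³ + (6x - 4)²` (`j = -12288000`): `E_d = [0, 36d, 0, -48d², 16d³]`.
Silverman, *Advanced Topics*, App. A §3 (`D = -3`, `f = 3`). [folklore] -/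
def cm27Model (d : ℤ) : WeierstrassCurve ℤ :=
  ⟨0, 36 * d, 0, -48 * d ^ 2, 16 * d ^ 3⟩

/-- The twist family of Vélu's quotient `[0, 36, 0, 432, 13392]` (`j = 0`):
`E'_d = [0, 36d, 0, 432d², 13392d³]` (the kernel-`x` codomain `[0, a, 0, -9b, -(27c + 8ab)]`).
[folklore] -/
def cm27Codomain (d : ℤ) : WeierstrassCurve ℤ :=
  ⟨0, 36 * d, 0, 432 * d ^ 2, 13392 * d ^ 3⟩

section Invariants

variable (d : ℤ)

/-- `E_d` base-changed along `ℤ → R`. [folklore] -/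
@[simp] theorem map_cm27Model {R : Type*} [CommRing R] (f : ℤ →+* R) :
    (cm27Model d).map f = ⟨0, 36 * (d : R), 0, -48 * (d : R) ^ 2, 16 * (d : R) ^ 3⟩ := by
  simp [cm27Model, WeierstrassCurve.map]

/-- `E'_d` base-changed along `ℤ → R`. [folklore] -/
@[simp] theorem map_cm27Codomain {R : Type*} [CommRing R] (f : ℤ →+* R) :
    (cm27Codomain d).map f = ⟨0, 36 * (d : R), 0, 432 * (d : R) ^ 2, 13392 * (d : R) ^ 3⟩ := by
  simp [cm27Codomain, WeierstrassCurve.map]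

/-- `E'_d` is the kernel-`x` quotient of `E_d`: `a = 36d`, `b = -48d²`, `c = 16d³`. [folklore] -/
theorem map_cm27Codomain_eq_kernelXThreeCodomain {R : Type*} [CommRing R] (f : ℤ →+* R) :
    (cm27Codomain d).map f = kernelXThreeCodomain (36 * (d : R)) (-48 * (d : R) ^ 2) (16 * (d : R) ^ 3) := by
  rw [map_cm27Codomain]
  ext <;> simp <;> ring

/-- `Δ(E_d) = -2¹²3⁵ d⁶`. [folklore] -/
theorem cm27Model_Δ : (cm27Model d).Δ = -(2 ^ 12 * 3 ^ 5 * d ^ 6) := by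
  simp only [cm27Model, Δ, b₂, b₄, b₆, b₈]; ring

/-- `c₄(E_d) = 2⁹·45 d²`. [folklore] -/
theorem cm27Model_c₄ : (cm27Model d).c₄ = 2 ^ 9 * 45 * d ^ 2 := by
  simp only [cm27Model, c₄, b₂, b₄]; ring

/-- `c₆(E_d) = -2⁹·6831 d³`. [folklore] -/
theorem cm27Model_c₆ : (cm27Model d).c₆ = -(2 ^ 9 * 6831 * d ^ 3) := by
  simp only [cm27Model, c₆, b₂, b₄, b₆]; ring

/-- `Δ(E'_d) = -2¹²3¹⁵ d⁶`. [folklore] -/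
theorem cm27Codomain_Δ : (cm27Codomain d).Δ = -(2 ^ 12 * 3 ^ 15 * d ^ 6) := by
  simp only [cm27Codomain, Δ, b₂, b₄, b₆, b₈]; ring

/-- `c₄(E'_d) = 0` (`j = 0`). [folklore] -/
theorem cm27Codomain_c₄ : (cm27Codomain d).c₄ = 0 := by
  simp only [cm27Codomain, c₄, b₂, b₄]; ring

/-- `c₆(E'_d) = -2⁹·3⁹ d³`. [folklore] -/
theorem cm27Codomain_c₆ : (cm27Codomain d).c₆ = -(2 ^ 9 * 3 ^ 9 * d ^ 3) := by
  simp only [cm27Codomain, c₆, b₂, b₄, b₆]; ring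

end Invariants

/-! ## Additive places: `p = 3`, odd `p ∣ d`, `p = 2` with `d` even -/

section Additive

variable (v : HeightOneSpectrum (𝓞 ℚ)) {d : ℤ}

/-- For odd `p ∣ 3d` or `p = 2 ∣ d` (`d` squarefree), **`E_d` has additive reduction at `p`**:
`ord_p(Δ) ∈ {5, 6, 11, 18} ∌ 12ℤ` and `3 ord_p(c₄) ≥ ord_p(Δ)` (`c₄ = 2⁹3²5 d²`).
[cite: SilvermanAEC2009, VII.5 Prop. 5.1(c)] -/
theorem hasAdditiveReductionAt_cm27Model (hsq : Squarefree d)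
    (hv : (natGenerator v : ℤ) ∣ 3 * d ∨ (natGenerator v = 2 ∧ (2 : ℤ) ∣ d)) :
    ((cm27Model d).map (Int.castRingHom ℚ)).HasAdditiveReductionAt v := by
  have hpZ := Rat.prime_natGenerator_int v
  by_cases hpd : (natGenerator v : ℤ) ∣ d
  · obtain ⟨d₀, rfl, hd₀⟩ := Int.exists_eq_mul_not_dvd_of_squarefree hpZ hsq hpd
    have hd6 : ¬ ((natGenerator v : ℕ) : ℤ) ∣ d₀ ^ 6 := fun h ↦ hd₀ (hpZ.dvd_of_dvd_pow h)
    by_cases hp2 : natGenerator v = 2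
    · -- `2 ∣ d`: `Δ = 2¹⁸ (-243 d₀⁶)`, `c₄ = 2¹¹ (45 d₀²)`
      have hm : ¬ ((natGenerator v : ℕ) : ℤ) ∣ -(243 * d₀ ^ 6) := fun h ↦ by
        rw [dvd_neg] at h
        rcases hpZ.dvd_or_dvd h with h | h
        · rw [hp2] at h; norm_num at h
        · exact hd6 h
      refine hasAdditiveReductionAt_map_of_data v _ (n := 18) (e := 11) (m := -(243 * d₀ ^ 6))
        (k := 45 * d₀ ^ 2) ?_ hm (by decide) ?_ (by norm_num)
      · rw [cm27Model_Δ, hp2]; push_cast; ring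
      · rw [cm27Model_c₄, hp2]; push_cast; ring
    by_cases hp3 : natGenerator v = 3
    · -- `3 ∣ d`: `Δ = 3¹¹ (-2¹² d₀⁶)`, `c₄ = 3⁴ (2560 d₀²)`
      have hm : ¬ ((natGenerator v : ℕ) : ℤ) ∣ -(2 ^ 12 * d₀ ^ 6) := fun h ↦ by
        rw [dvd_neg] at h
        rcases hpZ.dvd_or_dvd h with h | h
        · rw [hp3] at h; norm_num at h
        · exact hd6 h
      refine hasAdditiveReductionAt_map_of_data v _ (n := 11) (e := 4) (m := -(2 ^ 12 * d₀ ^ 6))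
        (k := 2560 * d₀ ^ 2) ?_ hm (by decide) ?_ (by norm_num)
      · rw [cm27Model_Δ, hp3]; push_cast; ring
      · rw [cm27Model_c₄, hp3]; push_cast; ring
    · -- other `p ∣ d`: `Δ = p⁶ (-2¹²3⁵ d₀⁶)`, `c₄ = p² (23040 d₀²)`
      have hm : ¬ ((natGenerator v : ℕ) : ℤ) ∣ -(2 ^ 12 * 3 ^ 5 * d₀ ^ 6) := fun h ↦ by
        rw [dvd_neg] at h
        rcases hpZ.dvd_or_dvd h with h | h
        · rcases hpZ.dvd_or_dvd h with h | h
          · exact Rat.not_natGenerator_dvd_of_ne v Nat.prime_two hp2 (hpZ.dvd_of_dvd_pow h)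
          · exact Rat.not_natGenerator_dvd_of_ne v Nat.prime_three hp3 (hpZ.dvd_of_dvd_pow h)
        · exact hd6 h
      refine hasAdditiveReductionAt_map_of_data v _ (n := 6) (e := 2)
        (m := -(2 ^ 12 * 3 ^ 5 * d₀ ^ 6)) (k := 23040 * d₀ ^ 2) ?_ hm (by decide) ?_ (by norm_num)
      · rw [cm27Model_Δ]; ring
      · rw [cm27Model_c₄]; ring
  · -- `p ∤ d`: then `p = 3`
    have hd6 : ¬ ((natGenerator v : ℕ) : ℤ) ∣ d ^ 6 := fun h ↦ hpd (hpZ.dvd_of_dvd_pow h)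
    have hp3 : natGenerator v = 3 := by
      rcases hv with h | ⟨hp2', h⟩
      · rcases hpZ.dvd_or_dvd h with h | h
        · exact Rat.natGenerator_eq_of_dvd v Nat.prime_three h
        · exact absurd h hpd
      · rw [hp2'] at hpd; push_cast at hpd; exact absurd h hpd
    have hm : ¬ ((natGenerator v : ℕ) : ℤ) ∣ -(2 ^ 12 * d ^ 6) := fun h ↦ by
      rw [dvd_neg] at h
      rcases hpZ.dvd_or_dvd h with h | h
      · rw [hp3] at h; norm_num at h
      · exact hd6 h
    refine hasAdditiveReductionAt_map_of_data v _ (n := 5) (e := 2) (m := -(2 ^ 12 * d ^ 6))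
      (k := 2560 * d ^ 2) ?_ hm (by decide) ?_ (by norm_num)
    · rw [cm27Model_Δ, hp3]; push_cast; ring
    · rw [cm27Model_c₄, hp3]; push_cast; ring

/-- For odd `p ∣ 3d` or `p = 2 ∣ d` (`d` squarefree), **`E'_d` has additive reduction at `p`**:
`ord_p(Δ) ∈ {6, 15, 18, 21} ∌ 12ℤ` and `c₄ = 0`. [cite: SilvermanAEC2009, VII.5 Prop. 5.1(c)] -/
theorem hasAdditiveReductionAt_cm27Codomain (hsq : Squarefree d)
    (hv : (natGenerator v : ℤ) ∣ 3 * d ∨ (natGenerator v = 2 ∧ (2 : ℤ) ∣ d)) :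
    ((cm27Codomain d).map (Int.castRingHom ℚ)).HasAdditiveReductionAt v := by
  have hpZ := Rat.prime_natGenerator_int v
  have hc : ∀ x : ℚ, v.valuation ℚ (((cm27Codomain d).c₄ : ℤ) : ℚ) ^ 3 ≤ v.valuation ℚ x := by
    intro x; rw [cm27Codomain_c₄]; simp
  by_cases hpd : (natGenerator v : ℤ) ∣ d
  · obtain ⟨d₀, rfl, hd₀⟩ := Int.exists_eq_mul_not_dvd_of_squarefree hpZ hsq hpd
    have hd6 : ¬ ((natGenerator v : ℕ) : ℤ) ∣ d₀ ^ 6 := fun h ↦ hd₀ (hpZ.dvd_of_dvd_pow h)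
    by_cases hp2 : natGenerator v = 2
    · have hm : ¬ ((natGenerator v : ℕ) : ℤ) ∣ -(3 ^ 15 * d₀ ^ 6) := fun h ↦ by
        rw [dvd_neg] at h
        rcases hpZ.dvd_or_dvd h with h | h
        · exact Rat.not_natGenerator_dvd_of_ne v Nat.prime_three (by rw [hp2]; decide)
            (hpZ.dvd_of_dvd_pow h)
        · exact hd6 h
      refine hasAdditiveReductionAt_map_of_Δ_eq v _ (n := 18) (m := -(3 ^ 15 * d₀ ^ 6)) ?_ hm
        (by decide) (hc _)
      rw [cm27Codomain_Δ, hp2]; push_cast; ring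
    by_cases hp3 : natGenerator v = 3
    · have hm : ¬ ((natGenerator v : ℕ) : ℤ) ∣ -(2 ^ 12 * d₀ ^ 6) := fun h ↦ by
        rw [dvd_neg] at h
        rcases hpZ.dvd_or_dvd h with h | h
        · rw [hp3] at h; norm_num at h
        · exact hd6 h
      refine hasAdditiveReductionAt_map_of_Δ_eq v _ (n := 21) (m := -(2 ^ 12 * d₀ ^ 6)) ?_ hm
        (by decide) (hc _)
      rw [cm27Codomain_Δ, hp3]; push_cast; ring
    · have hm : ¬ ((natGenerator v : ℕ) : ℤ) ∣ -(2 ^ 12 * 3 ^ 15 * d₀ ^ 6) := fun h ↦ by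
        rw [dvd_neg] at h
        rcases hpZ.dvd_or_dvd h with h | h
        · rcases hpZ.dvd_or_dvd h with h | h
          · exact Rat.not_natGenerator_dvd_of_ne v Nat.prime_two hp2 (hpZ.dvd_of_dvd_pow h)
          · exact Rat.not_natGenerator_dvd_of_ne v Nat.prime_three hp3 (hpZ.dvd_of_dvd_pow h)
        · exact hd6 h
      refine hasAdditiveReductionAt_map_of_Δ_eq v _ (n := 6) (m := -(2 ^ 12 * 3 ^ 15 * d₀ ^ 6))
        ?_ hm (by decide) (hc _)
      rw [cm27Codomain_Δ]; ring
  · have hd6 : ¬ ((natGenerator v : ℕ) : ℤ) ∣ d ^ 6 := fun h ↦ hpd (hpZ.dvd_of_dvd_pow h)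
    have hp3 : natGenerator v = 3 := by
      rcases hv with h | ⟨hp2', h⟩
      · rcases hpZ.dvd_or_dvd h with h | h
        · exact Rat.natGenerator_eq_of_dvd v Nat.prime_three h
        · exact absurd h hpd
      · rw [hp2'] at hpd; push_cast at hpd; exact absurd h hpd
    have hm : ¬ ((natGenerator v : ℕ) : ℤ) ∣ -(2 ^ 12 * d ^ 6) := fun h ↦ by
      rw [dvd_neg] at h
      rcases hpZ.dvd_or_dvd h with h | h
      · rw [hp3] at h; norm_num at h
      · exact hd6 h
    refine hasAdditiveReductionAt_map_of_Δ_eq v _ (n := 15) (m := -(2 ^ 12 * d ^ 6)) ?_ hm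
      (by decide) (hc _)
    rw [cm27Codomain_Δ, hp3]; push_cast; ring

end Additive

/-! ## `p = 2`, `d ≡ 3 (mod 4)`: additive reduction by Kraus's condition -/

section TwoThreeModFour

variable (v : HeightOneSpectrum (𝓞 ℚ)) {d : ℤ}

/-- `d = 4k + 3`: then `-6831 d³ ≡ 3 (mod 4)` and `-3⁹ d³ ≡ 3 (mod 4)`. [folklore] -/
theorem cm27_kraus_data {k : ℤ} (hd : d = 4 * k + 3) :
    (4 : ℤ) ∣ -6831 * d ^ 3 - 3 ∧ (4 : ℤ) ∣ -(3 ^ 9) * d ^ 3 - 3 := by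
  subst hd
  exact ⟨⟨-109296 * k ^ 3 - 245916 * k ^ 2 - 184437 * k - 46110, by ring⟩,
    ⟨-314928 * k ^ 3 - 708588 * k ^ 2 - 531441 * k - 132861, by ring⟩⟩

/-- **For `d ≡ 3 (mod 4)` squarefree, `E_d` and `E'_d` have additive reduction at `2`**
(`ord₂(Δ) = 12`; no good reduction by Kraus's necessary condition with `c₆ = 2⁹L`,
`L ≡ 3 (mod 4)`, `not_hasGoodReductionAt_two_of_c₆_eq_512_mul`; `ord₂(j) ≥ 0`).
[cite: Kraus1989, Prop. 2] [cite: SilvermanAEC2009, VII.5 Prop. 5.1] -/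
theorem hasAdditiveReductionAt_cm27_two_of_three_mod_four (hv : natGenerator v = 2) {k : ℤ}
    (hd : d = 4 * k + 3) :
    ((cm27Model d).map (Int.castRingHom ℚ)).HasAdditiveReductionAt v ∧
      ((cm27Codomain d).map (Int.castRingHom ℚ)).HasAdditiveReductionAt v := by
  obtain ⟨hN, hN'⟩ := cm27_kraus_data hd
  have hdodd : ¬ (2 : ℤ) ∣ d := by
    rw [hd]; intro ⟨m, hm⟩; omega
  have hd6 : ¬ ((natGenerator v : ℕ) : ℤ) ∣ d ^ 6 := fun h ↦ by
    rw [hv] at h; push_cast at h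
    exact hdodd (Int.prime_two.dvd_of_dvd_pow h)
  have hpZ := Rat.prime_natGenerator_int v
  have hm : ¬ ((natGenerator v : ℕ) : ℤ) ∣ -(243 * d ^ 6) := fun h ↦ by
    rw [dvd_neg] at h
    rcases hpZ.dvd_or_dvd h with h | h
    · rw [hv] at h; norm_num at h
    · exact hd6 h
  have hm' : ¬ ((natGenerator v : ℕ) : ℤ) ∣ -(3 ^ 15 * d ^ 6) := fun h ↦ by
    rw [dvd_neg] at h
    rcases hpZ.dvd_or_dvd h with h | h
    · exact Rat.not_natGenerator_dvd_of_ne v Nat.prime_three (by rw [hv]; decide)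
        (hpZ.dvd_of_dvd_pow h)
    · exact hd6 h
  have hvΔ : v.valuation ℚ ((cm27Model d).map (Int.castRingHom ℚ)).Δ = WithZero.exp (-12 : ℤ) := by
    rw [map_Δ, eq_intCast, cm27Model_Δ, show -((2 : ℤ) ^ 12 * 3 ^ 5 * d ^ 6) =
      (natGenerator v : ℤ) ^ 12 * (-(243 * d ^ 6)) by rw [hv]; push_cast; ring]
    push_cast
    have := Rat.valuation_pow_mul_intCast v hm 12
    push_cast at this
    exact this
  have hvΔ' : v.valuation ℚ ((cm27Codomain d).map (Int.castRingHom ℚ)).Δ = WithZero.exp (-12 : ℤ) := by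
    rw [map_Δ, eq_intCast, cm27Codomain_Δ, show -((2 : ℤ) ^ 12 * 3 ^ 15 * d ^ 6) =
      (natGenerator v : ℤ) ^ 12 * (-(3 ^ 15 * d ^ 6)) by rw [hv]; push_cast; ring]
    push_cast
    have := Rat.valuation_pow_mul_intCast v hm' 12
    push_cast at this
    exact this
  have hng := not_hasGoodReductionAt_two_of_c₆_eq_512_mul v _ hv hvΔ (N := -6831 * d ^ 3)
    (by rw [map_c₆, eq_intCast, cm27Model_c₆]; push_cast; ring) hN
  have hng' := not_hasGoodReductionAt_two_of_c₆_eq_512_mul v _ hv hvΔ' (N := -(3 ^ 9) * d ^ 3)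
    (by rw [map_c₆, eq_intCast, cm27Codomain_c₆]; push_cast; ring) hN'
  obtain ⟨h₁, h₂, h₃, h₄, h₆⟩ := valuation_map_a_le_one v (cm27Model d)
  obtain ⟨h₁', h₂', h₃', h₄', h₆'⟩ := valuation_map_a_le_one v (cm27Codomain d)
  refine ⟨hasAdditiveReductionAt_of_not_hasGoodReductionAt_of_cube_le v _ h₁ h₂ h₃ h₄ h₆ hng ?_,
    hasAdditiveReductionAt_of_not_hasGoodReductionAt_of_cube_le v _ h₁' h₂' h₃' h₄' h₆' hng' ?_⟩
  · rw [map_Δ, map_c₄, eq_intCast, eq_intCast]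
    refine Rat.valuation_cube_le_of_dvd v (e := 9) (n := 12) (m := -(243 * d ^ 6)) ?_ ?_ hm (by norm_num)
    · rw [cm27Model_c₄, hv]; exact ⟨45 * d ^ 2, by push_cast; ring⟩
    · rw [cm27Model_Δ, hv]; push_cast; ring
  · rw [map_Δ, map_c₄, eq_intCast, eq_intCast, cm27Codomain_c₄]
    simp

end TwoThreeModFour

/-! ## `p = 2`, `d ≡ 1 (mod 4)`: good (supersingular) reduction at `2`, explicit models -/

section TwoOneModFour

variable (v : HeightOneSpectrum (𝓞 ℚ)) {d : ℤ}

/-- The `2`-integral model of `E_d` for `d = 4k + 1`: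
`⟨2, -12d, 0, 4⟩ • E_d = [0, 0, 1, -30d², (253d³ - 1)/4]`. [folklore] -/
def cm27GoodModel (k : ℤ) : WeierstrassCurve ℤ :=
  ⟨0, 0, 1, -480 * k ^ 2 - 240 * k - 30, 4048 * k ^ 3 + 3036 * k ^ 2 + 759 * k + 63⟩

/-- The `2`-integral model of `E'_d` for `d = 4k + 1`:
`⟨2, -12d, 0, 4⟩ • E'_d = [0, 0, 1, 0, (729d³ - 1)/4]`. [folklore] -/
def cm27GoodCodomain (k : ℤ) : WeierstrassCurve ℤ :=
  ⟨0, 0, 1, 0, 11664 * k ^ 3 + 8748 * k ^ 2 + 2187 * k + 182⟩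

variable (k : ℤ)

/-- `⟨2, -12d, 0, 4⟩ • E_d = cm27GoodModel k` for `d = 4k + 1`. [folklore] -/
theorem smul_cm27Model_eq :
    (⟨Units.mk0 2 two_ne_zero, -12 * (4 * k + 1 : ℚ), 0, 4⟩ : VariableChange ℚ) •
        (cm27Model (4 * k + 1)).map (Int.castRingHom ℚ) =
      (cm27GoodModel k).map (Int.castRingHom ℚ) := by
  rw [map_cm27Model]
  ext <;> simp only [variableChange_a₁, variableChange_a₂, variableChange_a₃, variableChange_a₄,
    variableChange_a₆, Units.val_inv_eq_inv_val, Units.val_mk0, cm27GoodModel, map_a₁, map_a₂,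
    map_a₃, map_a₄, map_a₆, eq_intCast] <;> push_cast <;> field_simp <;> ring

/-- `⟨2, -12d, 0, 4⟩ • E'_d = cm27GoodCodomain k` for `d = 4k + 1`. [folklore] -/
theorem smul_cm27Codomain_eq :
    (⟨Units.mk0 2 two_ne_zero, -12 * (4 * k + 1 : ℚ), 0, 4⟩ : VariableChange ℚ) •
        (cm27Codomain (4 * k + 1)).map (Int.castRingHom ℚ) =
      (cm27GoodCodomain k).map (Int.castRingHom ℚ) := by
  rw [map_cm27Codomain]
  ext <;> simp only [variableChange_a₁, variableChange_a₂, variableChange_a₃, variableChange_a₄,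
    variableChange_a₆, Units.val_inv_eq_inv_val, Units.val_mk0, cm27GoodCodomain, map_a₁, map_a₂,
    map_a₃, map_a₄, map_a₆, eq_intCast] <;> push_cast <;> field_simp <;> ring

/-- The explicit models have odd discriminants `-3⁵d⁶`, `-3¹⁵d⁶`. [folklore] -/
theorem cm27Good_Δ :
    (cm27GoodModel k).Δ = -(243 * (4 * k + 1) ^ 6) ∧
      (cm27GoodCodomain k).Δ = -(14348907 * (4 * k + 1) ^ 6) := by
  refine ⟨?_, ?_⟩ <;>
    simp only [cm27GoodModel, cm27GoodCodomain, Δ, b₂, b₄, b₆, b₈] <;> ring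

/-- `#M(𝔽₂) = 3` for the model of `E_d` (reduction `y² + y = x³ + c`, supersingular). [folklore] -/
theorem natCard_cm27GoodModel_zmod_two :
    Nat.card ((cm27GoodModel k).map (Int.castRingHom (ZMod 2))).toAffine.Point = 3 := by
  have h : (cm27GoodModel k).map (Int.castRingHom (ZMod 2)) =
      ⟨0, 0, 1, -480 * (k : ZMod 2) ^ 2 - 240 * (k : ZMod 2) - 30,
        4048 * (k : ZMod 2) ^ 3 + 3036 * (k : ZMod 2) ^ 2 + 759 * (k : ZMod 2) + 63⟩ := by
    simp [cm27GoodModel, WeierstrassCurve.map]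
  obtain hx | hx := (show ∀ x : ZMod 2, x = 0 ∨ x = 1 by decide) (k : ZMod 2) <;>
    (rw [hx] at h; rw [h, natCard_point_eq_one_add_card _ (by decide)]; decide)

/-- `#M(𝔽₂) = 3` for the model of `E'_d` (reduction `y² + y = x³ + c`). [folklore] -/
theorem natCard_cm27GoodCodomain_zmod_two :
    Nat.card ((cm27GoodCodomain k).map (Int.castRingHom (ZMod 2))).toAffine.Point = 3 := by
  have h : (cm27GoodCodomain k).map (Int.castRingHom (ZMod 2)) =
      ⟨0, 0, 1, 0, 11664 * (k : ZMod 2) ^ 3 + 8748 * (k : ZMod 2) ^ 2 + 2187 * (k : ZMod 2) + 182⟩ := by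
    simp [cm27GoodCodomain, WeierstrassCurve.map]
  obtain hx | hx := (show ∀ x : ZMod 2, x = 0 ∨ x = 1 by decide) (k : ZMod 2) <;>
    (rw [hx] at h; rw [h, natCard_point_eq_one_add_card _ (by decide)]; decide)

variable {k}

/-- `E_d` is elliptic over `ℚ` for `d ≠ 0`. [folklore] -/
theorem isElliptic_cm27Model_map (hd : d ≠ 0) : ((cm27Model d).map (Int.castRingHom ℚ)).IsElliptic := by
  refine ⟨isUnit_iff_ne_zero.mpr ?_⟩
  rw [map_Δ, cm27Model_Δ]
  simp only [map_neg, map_mul, map_pow, eq_intCast, Int.cast_ofNat, neg_ne_zero]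
  exact mul_ne_zero (by norm_num) (pow_ne_zero _ (Int.cast_ne_zero.mpr hd))

/-- `E'_d` is elliptic over `ℚ` for `d ≠ 0`. [folklore] -/
theorem isElliptic_cm27Codomain_map (hd : d ≠ 0) :
    ((cm27Codomain d).map (Int.castRingHom ℚ)).IsElliptic := by
  refine ⟨isUnit_iff_ne_zero.mpr ?_⟩
  rw [map_Δ, cm27Codomain_Δ]
  simp only [map_neg, map_mul, map_pow, eq_intCast, Int.cast_ofNat, neg_ne_zero]
  exact mul_ne_zero (by norm_num) (pow_ne_zero _ (Int.cast_ne_zero.mpr hd))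

/-- **`d ≡ 1 (mod 4)`: equal local polynomials `1 + 2T²` at `2`** (good supersingular reduction,
`a₂ = 0` on both sides). [cite: Knapp1993, proof of Thm. 11.67] -/
theorem localPolynomial_cm27_two_eq_of_one_mod_four (hv : natGenerator v = 2) (hd : d = 4 * k + 1) :
    (((cm27Model d).map (Int.castRingHom ℚ)).baseChange (v.adicCompletion ℚ)).localPolynomial
        (v.adicCompletionIntegers ℚ) =
      (((cm27Codomain d).map (Int.castRingHom ℚ)).baseChange (v.adicCompletion ℚ)).localPolynomial
        (v.adicCompletionIntegers ℚ) := by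
  have hd0 : d ≠ 0 := by omega
  haveI := isElliptic_cm27Model_map hd0
  haveI := isElliptic_cm27Codomain_map hd0
  have hodd : ¬ (2 : ℤ) ∣ 4 * k + 1 := by omega
  subst hd
  obtain ⟨hΔ, hΔ'⟩ := cm27Good_Δ k
  have hodd' : ∀ c : ℤ, ¬ (2 : ℤ) ∣ c → ¬ (2 : ℤ) ∣ -(c * (4 * k + 1) ^ 6) := fun c hc h ↦ by
    rw [dvd_neg] at h
    rcases Int.prime_two.dvd_or_dvd h with h | h
    · exact hc h
    · exact hodd (Int.prime_two.dvd_of_dvd_pow h)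
  have e1 := localPolynomial_two_of_model v hv ((cm27Model (4 * k + 1)).map (Int.castRingHom ℚ))
    (cm27GoodModel k) ⟨Units.mk0 2 two_ne_zero, -12 * (4 * k + 1 : ℚ), 0, 4⟩
    (smul_cm27Model_eq k) (by rw [hΔ]; exact hodd' 243 (by decide))
  have e2 := localPolynomial_two_of_model v hv ((cm27Codomain (4 * k + 1)).map (Int.castRingHom ℚ))
    (cm27GoodCodomain k) ⟨Units.mk0 2 two_ne_zero, -12 * (4 * k + 1 : ℚ), 0, 4⟩
    (smul_cm27Codomain_eq k) (by rw [hΔ']; exact hodd' 14348907 (by decide))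
  rw [e1, e2, natCard_cm27GoodModel_zmod_two, natCard_cm27GoodCodomain_zmod_two]

end TwoOneModFour

/-! ## Good places `p ∤ 6d` -/

section Good

variable {p : ℕ} [Fact p.Prime] {d : ℤ}

/-- **`#E_d(𝔽_p) = #E'_d(𝔽_p)` for `p ∤ 6d`**: the reductions are the kernel-`x` `3`-isogenous
pair `[0, a, 0, b, c] → [0, a, 0, -9b, -(27c + 8ab)]` over `𝔽_p` (`a = 36d`, `b = -48d²`,
`c = 16d³`, `b² = 4ac`), hence have equally many points (`natCard_point_kernelXThree_eq`, the
prime-degree torsor lemma applied to the isogeny and to its dual). This is Knapp's "`#E_p = #E'_p`".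
[cite: Knapp1993, proof of Thm. 11.67, (11.89) (PDF p. 282)] -/
theorem natCard_point_cm27_zmod_eq (hpd : ¬ (p : ℤ) ∣ 6 * d) :
    Nat.card ((cm27Model d).map (Int.castRingHom (ZMod p))).toAffine.Point =
      Nat.card ((cm27Codomain d).map (Int.castRingHom (ZMod p))).toAffine.Point := by
  obtain ⟨h2, h3, hd⟩ := two_ne_zero_and_of_not_dvd hpd
  have hE : (cm27Model d).map (Int.castRingHom (ZMod p)) =
      ⟨0, 36 * (d : ZMod p), 0, -48 * (d : ZMod p) ^ 2, 16 * (d : ZMod p) ^ 3⟩ := map_cm27Model d _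
  have hΔ : (⟨0, 36 * (d : ZMod p), 0, -48 * (d : ZMod p) ^ 2, 16 * (d : ZMod p) ^ 3⟩ :
      WeierstrassCurve (ZMod p)).Δ ≠ 0 := by
    rw [← hE, map_Δ, cm27Model_Δ]
    simp only [map_neg, map_mul, map_pow, eq_intCast, Int.cast_ofNat, neg_ne_zero]
    exact mul_ne_zero (mul_ne_zero (pow_ne_zero _ h2) (pow_ne_zero _ h3)) (pow_ne_zero _ hd)
  rw [hE, map_cm27Codomain_eq_kernelXThreeCodomain]
  exact natCard_point_kernelXThree_eq _ _ _ (by ring) hΔ h3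

end Good

/-! ## Assembly -/

section Assembly

variable {d : ℤ}

/-- **The local polynomials of `E_d` and `E'_d` agree at every finite place of `ℚ`**
(`d` squarefree). [cite: Knapp1993, proof of Thm. 11.67 (PDF pp. 281–282)] -/
theorem localPolynomial_cm27_eq (hsq : Squarefree d) (v : HeightOneSpectrum (𝓞 ℚ)) :
    (((cm27Model d).map (Int.castRingHom ℚ)).baseChange (v.adicCompletion ℚ)).localPolynomial
        (v.adicCompletionIntegers ℚ) =
      (((cm27Codomain d).map (Int.castRingHom ℚ)).baseChange (v.adicCompletion ℚ)).localPolynomial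
        (v.adicCompletionIntegers ℚ) := by
  have hpZ := Rat.prime_natGenerator_int v
  by_cases hp2 : natGenerator v = 2
  · -- the place over `2`
    have hmod : (2 : ℤ) ∣ d ∨ (∃ k, d = 4 * k + 3) ∨ (∃ k, d = 4 * k + 1) := by
      rcases Int.emod_two_eq_zero_or_one d with h | h
      · exact Or.inl (Int.dvd_of_emod_eq_zero h)
      · right
        have : d % 4 = 1 ∨ d % 4 = 3 := by omega
        rcases this with h1 | h3
        · exact Or.inr ⟨d / 4, by omega⟩
        · exact Or.inl ⟨d / 4, by omega⟩
    rcases hmod with h | ⟨k, hk⟩ | ⟨k, hk⟩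
    · exact localPolynomial_eq_of_hasAdditiveReductionAt v
        (hasAdditiveReductionAt_cm27Model v hsq (Or.inr ⟨hp2, h⟩))
        (hasAdditiveReductionAt_cm27Codomain v hsq (Or.inr ⟨hp2, h⟩))
    · obtain ⟨h1, h2⟩ := hasAdditiveReductionAt_cm27_two_of_three_mod_four v hp2 hk
      exact localPolynomial_eq_of_hasAdditiveReductionAt v h1 h2
    · exact localPolynomial_cm27_two_eq_of_one_mod_four v hp2 hk
  by_cases hv : (natGenerator v : ℤ) ∣ 3 * d
  · exact localPolynomial_eq_of_hasAdditiveReductionAt v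
      (hasAdditiveReductionAt_cm27Model v hsq (Or.inl hv))
      (hasAdditiveReductionAt_cm27Codomain v hsq (Or.inl hv))
  · -- good prime `p ≥ 5`, `p ∤ d`
    haveI := Fact.mk (prime_natGenerator v)
    have h6 : ¬ (natGenerator v : ℤ) ∣ 6 * d := fun h ↦ by
      rw [show (6 : ℤ) * d = 2 * (3 * d) by ring] at h
      rcases hpZ.dvd_or_dvd h with h | h
      · exact hp2 (Rat.natGenerator_eq_of_dvd v Nat.prime_two h)
      · exact hv h
    have hdvd : ∀ (k l : ℕ), ¬ (natGenerator v : ℤ) ∣ -(2 ^ k * 3 ^ l * d ^ 6) := by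
      intro k l h
      rw [dvd_neg] at h
      rcases hpZ.dvd_or_dvd h with h | h
      · rcases hpZ.dvd_or_dvd h with h | h
        · exact hp2 (Rat.natGenerator_eq_of_dvd v Nat.prime_two (hpZ.dvd_of_dvd_pow h))
        · exact hv ((hpZ.dvd_of_dvd_pow h).trans (dvd_mul_right 3 d))
      · exact hv ((hpZ.dvd_of_dvd_pow h).mul_left 3)
    refine localPolynomial_map_eq_of_natCard_eq v _ _ ?_ ?_ (natCard_point_cm27_zmod_eq h6)
    · rw [cm27Model_Δ]; exact hdvd 12 5
    · rw [cm27Codomain_Δ]; exact hdvd 12 15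

/-- **`L(E_d, s) = L(E'_d, s)`** for the `3`-isogenous CM curves `E_d = [0, 36d, 0, -48d², 16d³]`
(`j = -12288000`) and `E'_d = [0, 36d, 0, 432d², 13392d³]` (`j = 0`), every squarefree `d`:
Knapp's Theorem 11.67 for this isogeny class, for Mathlib's `WeierstrassCurve.LFunction`.
[cite: Knapp1993, Thm. 11.67 (PDF p. 281)] -/
theorem LFunction_cm27_eq (hsq : Squarefree d) :
    ((cm27Model d).map (Int.castRingHom ℚ)).LFunction =
      ((cm27Codomain d).map (Int.castRingHom ℚ)).LFunction :=
  LFunction_eq_of_forall_localPolynomial_eq (localPolynomial_cm27_eq hsq)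

/-- `E_d ~ E'_d` over `ℚ` (the kernel-`x` `3`-isogeny; Vélu). [cite: CremonaAlgorithms1997, §3.8] -/
theorem isIsogenous_cm27Model (hd : d ≠ 0) :
    IsIsogenous ((cm27Model d).map (Int.castRingHom ℚ)) ((cm27Codomain d).map (Int.castRingHom ℚ)) := by
  have hE : (cm27Model d).map (Int.castRingHom ℚ) =
      ⟨0, 36 * (d : ℚ), 0, -48 * (d : ℚ) ^ 2, 16 * (d : ℚ) ^ 3⟩ := map_cm27Model d _
  have hΔ : (⟨0, 36 * (d : ℚ), 0, -48 * (d : ℚ) ^ 2, 16 * (d : ℚ) ^ 3⟩ : WeierstrassCurve ℚ).Δ ≠ 0 := by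
    rw [← hE]; haveI := isElliptic_cm27Model_map hd; exact ((cm27Model d).map (Int.castRingHom ℚ)).isUnit_Δ.ne_zero
  rw [hE, map_cm27Codomain_eq_kernelXThreeCodomain]
  exact (isKernelXThreePair_mk (by ring) hΔ).isIsogenous

/-- **Knapp 11.67 for the class `j = -12288000 ~ 0`, in the form consumed by the CM reductions**.
[cite: Knapp1993, Thm. 11.67] -/
theorem isIsogenous_and_LFunction_eq_cm27 (hd : d ≠ 0) (hsq : Squarefree d) :
    IsIsogenous ((cm27Model d).map (Int.castRingHom ℚ)) ((cm27Codomain d).map (Int.castRingHom ℚ)) ∧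
      ((cm27Model d).map (Int.castRingHom ℚ)).LFunction =
        ((cm27Codomain d).map (Int.castRingHom ℚ)).LFunction :=
  ⟨isIsogenous_cm27Model hd, LFunction_cm27_eq hsq⟩

end Assembly

end WeierstrassCurve
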